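import Summits.NavierStokesRegularity.NavierStokesRegularity.Theorems.ExtremiserTransienceNearExtremalTransienceExtremiserLiouvilleConstantSpeedJetBarycentreBumps
import Summits.NavierStokesRegularity.NavierStokesRegularity.Theorems.ExtremiserTransienceNearExtremalTransienceExtremiserLiouvilleConstantSpeedAxialPairingL6
import HarnessLib

/-!
# Crux `ExtremiserTransience.NearExtremalTransience` (stmt-NavierStokesRegularity-21883), line `extremiser_liouville`,
# stub K1b — THE MULTIPLIER HAS ZERO BARYCENTRE FOR EVERY RESIDUE OBJECT: `∫ v dμ = 0` (flat or jet)

`--supports stmt-NavierStokesRegularity-21883` (helper).  Author: prover seat `ns-el-k1b` (g6).  g5 proved `∫ v dμ = 0` for the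
residue JET (`…ConstantSpeedJetBarycentre{,Zero,Bumps}`); the only jet-specific input was the vanishing of the axial pairing in
the blow-down, which `…ConstantSpeedAxialPairingL6` now derives from `v − c ∈ L⁶` alone — and EVERY residue object has
`v − c ∈ L⁶` (g2, `exists_farFieldLimit`).  This file re-runs g5's three steps verbatim with the hypothesis
`MemLp (v − c) 6` in place of the jet data (axial frame `c = (0,0,c₂)`):

* `inner_barycentre_eq_zero_of_horizontalGradient_of_memLp` : `⟪Ψ 0, ∫ v dμ⟫ = 0` for solenoidal `Ψ ∈ C_c^∞` whose Laplacian is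
  horizontally a gradient;
* `inner_testField_barycentre_eq_zero_of_memLp` : the same for g5's family `Ψ_φ = ∇(∂₂φ) − (Δφ)e₂`;
* `integral_barycentre_eq_zero_of_memLp` : **`∫ v dμ = 0`**.

CONSEQUENCES (with g3's `…MultiplierIdentities` and g6's `…BlowDownVorticity`): for every residue object `μ(ℝ³) = κ⋆²ZW = S²/M²`
exactly, `∫⟪v, c⟫dμ = 0`, the Stokeslet law has no point force, and the blow-down vorticity `R²ω(R·)` vanishes in `𝒟′` — for the
FLAT alternative as well as for the jet (`…ConstantSpeedBarycentreZeroCorollaries`).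

WHAT THIS IS NOT: K1b is NOT proved; nothing here proves NS regularity. [folklore]
-/

noncomputable section

open Set Filter Topology MeasureTheory Metric Function
open scoped ENNReal NNReal Topology InnerProductSpace RealInnerProductSpace ContDiff Laplacian
open Literature.Analysis.FluidPDE Literature.Analysis

namespace Summit.NavierStokesRegularity.NavierStokesRegularity.Theorems

-- the problem directory repeats the summit name (`NavierStokesRegularity/NavierStokesRegularity`)
set_option linter.dupNamespace false

namespace ExtremiserLiouville

open DepletionLadder.KStar DepletionLadder.KStar.HalfSpace

variable {v Ψ : E3 → E3} {c : E3} {φ : E3 → ℝ}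

/-- **The jet's multiplier barycentre is orthogonal to `Ψ(0)` for every solenoidal `Ψ` whose Laplacian is horizontally a
gradient.**  Setting: `v` smooth, divergence free, `‖v‖ ≡ M`, `D¹v, D²v ∈ L²`; `μ` a finite measure with the multiplier equation;
axial far field `c = (0,0,c₂)`, `‖c‖ = M`; `v − c ∈ L⁶` (EVERY residue object, g2's `exists_farFieldLimit`); `Ψ ∈ C_c^∞` solenoidal and `g ∈ C¹_c` with `(ΔΨ)(y)ᵢ = ∂ᵢ g(y)` for `i ≠ 2`.  Then **`⟪Ψ 0, ∫ v dμ⟫ = 0`**. [folklore] -/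
theorem inner_barycentre_eq_zero_of_horizontalGradient_of_memLp (hv : ContDiff ℝ ∞ v) (hdiv : VectorCalculus.IsDivFree v) {M : ℝ}
    (hM : ∀ x, ‖v x‖ = M) (h1 : ∫⁻ x, ‖iteratedFDeriv ℝ 1 v x‖ₑ ^ 2 < ⊤) (h2 : ∫⁻ x, ‖iteratedFDeriv ℝ 2 v x‖ₑ ^ 2 < ⊤)
    (μ : Measure E3) [IsFiniteMeasure μ]
    (hμ : ∀ φ : E3 → E3, ContDiff ℝ ∞ φ → HasCompactSupport φ → VectorCalculus.IsDivFree φ →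
      Jst v * J1 v φ - kStar ^ 2 * M ^ 2 * (Wpa v * A1 v φ + Zen v * C1 v φ) = ∫ x, ⟪v x, φ x⟫_ℝ ∂μ)
    (hc0 : c 0 = 0) (hc1 : c 1 = 0) (hc2 : c 2 ≠ 0) (hcM : ‖c‖ = M)
    (hL6 : MemLp (fun x => v x - c) 6 volume)
    (hΨ : ContDiff ℝ ∞ Ψ) (hΨc : HasCompactSupport Ψ) (hΨdiv : VectorCalculus.IsDivFree Ψ)
    {g : E3 → ℝ} (hg : ContDiff ℝ 1 g) (hgc : HasCompactSupport g)
    (hhor : ∀ (y : E3) (i : Fin 3), i ≠ 2 → (Δ Ψ) y i = fderiv ℝ g y (EuclideanSpace.single i (1 : ℝ))) :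
    ⟪Ψ 0, ∫ x, v x ∂μ⟫_ℝ = 0 := by
  -- the deviation `V = v − c` and its constant-speed structure
  set V : E3 → E3 := fun x => v x - c with hVdef
  have hV1 : ContDiff ℝ 1 V := (hv.of_le (by norm_cast)).sub contDiff_const
  have hVdiv : VectorCalculus.IsDivFree V := isDivFree_sub_const hdiv c
  have hVc : ∀ x, ⟪V x, c⟫_ℝ = -(‖V x‖ ^ 2 / 2) := fun x => by
    have h : ‖c + V x‖ = ‖c‖ := by rw [hVdef]; simp only [add_sub_cancel]; rw [hM, hcM]
    exact (inner_eq_of_norm_add_eq h).1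
  -- the Laplacian of the test field: continuous with compact support (`ΔΨ = −curl curl Ψ`)
  have hΨ2 : ContDiff ℝ 2 Ψ := hΨ.of_le (by norm_cast)
  have hΔeq : (Δ Ψ) = fun y => -curl (curl Ψ) y := by
    funext y; rw [curl_curl_eq_neg_laplacian hΨ2 hΨdiv y, neg_neg]
  have hcΨ : ContDiff ℝ ∞ (curl Ψ) := contDiff_curl hΨ
  have hccc : Continuous (curl (curl Ψ)) := continuous_curl (hcΨ.of_le (by norm_cast))
  have hΔc : Continuous (Δ Ψ) := by rw [hΔeq]; exact hccc.neg
  have hΔsupp : HasCompactSupport (Δ Ψ) := by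
    rw [hΔeq]
    exact (hasCompactSupport_curl_of (hasCompactSupport_curl_of hΨc)).comp_left (g := fun y : E3 => -y) neg_zero
  -- the gradient of `g`: continuous with compact support
  have hgradc : Continuous (gradient g) := by
    have e : gradient g = fun y => (InnerProductSpace.toDual ℝ E3).symm (fderiv ℝ g y) := rfl
    rw [e]; exact (InnerProductSpace.toDual ℝ E3).symm.continuous.comp (hg.continuous_fderiv one_ne_zero)
  have hgrads : HasCompactSupport (gradient g) := by
    have e : gradient g = fun y => (InnerProductSpace.toDual ℝ E3).symm (fderiv ℝ g y) := rfl
    rw [e]; exact (hgc.fderiv (𝕜 := ℝ)).comp_left (map_zero _)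
  -- the axial remainder `G = ΔΨ − ∇g` (horizontal components zero)
  set G : E3 → E3 := fun y => (Δ Ψ) y + -gradient g y with hGdef
  have hGc : Continuous G := hΔc.add hgradc.neg
  have hGs : HasCompactSupport G := hΔsupp.add (hgrads.comp_left (g := fun y : E3 => -y) neg_zero)
  have hGh : ∀ (y : E3) (i : Fin 3), i ≠ 2 → G y i = 0 := by
    intro y i hi
    show ((Δ Ψ) y + -gradient g y) i = 0
    rw [PiLp.add_apply, PiLp.neg_apply, gradient_apply_eq_fderiv, hhor y i hi, add_neg_cancel]
  -- the key identity: the Laplacian pairing is an axial pairing (for `R > 0`)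
  have hkey : ∀ R : ℝ, 0 < R →
      (∫ x, ⟪v x - c, (Δ Ψ) (R⁻¹ • x)⟫_ℝ) = ∫ x, V x 2 * G (R⁻¹ • x) 2 := by
    intro R hR
    have hsplit : ∀ x, ⟪v x - c, (Δ Ψ) (R⁻¹ • x)⟫_ℝ = V x 2 * G (R⁻¹ • x) 2 + ⟪V x, gradient g (R⁻¹ • x)⟫_ℝ := by
      intro x
      have eΔ : (Δ Ψ) (R⁻¹ • x) = G (R⁻¹ • x) + gradient g (R⁻¹ • x) := by
        show (Δ Ψ) (R⁻¹ • x) = ((Δ Ψ) (R⁻¹ • x) + -gradient g (R⁻¹ • x)) + gradient g (R⁻¹ • x)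
        rw [neg_add_cancel_right]
      rw [show v x - c = V x from rfl, eΔ, inner_add_right]
      congr 1
      -- `⟪V x, G y⟫ = V₂ G₂` since `G₀ = G₁ = 0`
      simp only [PiLp.inner_apply, RCLike.inner_apply, conj_trivial, Fin.sum_univ_three,
        hGh _ 0 (by decide), hGh _ 1 (by decide)]
      ring
    have iG : Integrable (fun x => V x 2 * G (R⁻¹ • x) 2) volume := by
      have hGR : Continuous fun x : E3 => G (R⁻¹ • x) := hGc.comp (continuous_id.const_smul R⁻¹)
      have hGRc : HasCompactSupport fun x : E3 => G (R⁻¹ • x) := hGs.comp_smul (inv_ne_zero hR.ne')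
      refine (((PiLp.continuous_apply 2 _ (2 : Fin 3)).comp hV1.continuous).mul
        ((PiLp.continuous_apply 2 _ (2 : Fin 3)).comp hGR)).integrable_of_hasCompactSupport (hGRc.mono fun x hx => ?_)
      rw [mem_support] at hx ⊢
      contrapose! hx
      show V x 2 * G (R⁻¹ • x) 2 = 0
      rw [hx, PiLp.zero_apply, mul_zero]
    have igrad : Integrable (fun x => ⟪V x, gradient g (R⁻¹ • x)⟫_ℝ) volume := by
      have hgR : Continuous fun x : E3 => gradient g (R⁻¹ • x) := hgradc.comp (continuous_id.const_smul R⁻¹)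
      have hgRc : HasCompactSupport fun x : E3 => gradient g (R⁻¹ • x) := hgrads.comp_smul (inv_ne_zero hR.ne')
      refine (hV1.continuous.inner hgR).integrable_of_hasCompactSupport (hgRc.mono fun x hx => ?_)
      rw [mem_support] at hx ⊢
      contrapose! hx
      rw [hx, inner_zero_right]
    simp_rw [hsplit]
    rw [integral_add iG igrad, integral_inner_gradient_rescale_eq_zero hV1 hVdiv hg hgc hR, add_zero]
  -- the two limits
  have hA := tendsto_blowDown_laplacian_pairing hv hM h1 h2 μ hμ hΨ hΨc hΨdiv c
  have hB := (tendsto_axial_pairing_rescale_of_memLp hV1.continuous hVc hc0 hc1 hc2 hL6 hGc hGs).const_mul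
    (kStar ^ 2 * M ^ 2 * Wpa v)
  rw [mul_zero] at hB
  have hAB : Tendsto (fun R : ℝ => kStar ^ 2 * M ^ 2 * Wpa v * (R⁻¹ * R⁻¹ * ∫ x, ⟪v x - c, (Δ Ψ) (R⁻¹ • x)⟫_ℝ)) atTop
      (𝓝 0) := by
    refine hB.congr' ((eventually_gt_atTop 0).mono fun R hR => ?_)
    show kStar ^ 2 * M ^ 2 * Wpa v * (R⁻¹ * R⁻¹ * ∫ x, V x 2 * G (R⁻¹ • x) 2) =
      kStar ^ 2 * M ^ 2 * Wpa v * (R⁻¹ * R⁻¹ * ∫ x, ⟪v x - c, (Δ Ψ) (R⁻¹ • x)⟫_ℝ)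
    rw [hkey R hR]
  have hlim : (∫ x, ⟪v x, Ψ 0⟫_ℝ ∂μ) = 0 := tendsto_nhds_unique hA hAB
  -- `∫⟪v, Ψ 0⟫dμ = ⟪Ψ 0, ∫ v dμ⟫`
  have hvi : Integrable v μ :=
    (integrable_const M).mono' hv.continuous.aestronglyMeasurable (Eventually.of_forall fun x => (hM x).le)
  rw [← integral_inner hvi]
  rw [← hlim]
  exact integral_congr_ae (Eventually.of_forall fun x => real_inner_comm _ _)

/-- **`⟪Ψ_φ(0), ∫ v dμ⟫ = 0` for every `φ ∈ C_c^∞`**, for EVERY residue object (`v − c ∈ L⁶`) in the axial frame with its multiplier `μ`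
(hypotheses as in `inner_barycentre_eq_zero_of_horizontalGradient`), where
`Ψ_φ = (∂₀∂₂φ)e₀ + (∂₁∂₂φ)e₁ + (∂₂∂₂φ − Δφ)e₂ = ∇(∂₂φ) − (Δφ)e₂`. [folklore] -/
theorem inner_testField_barycentre_eq_zero_of_memLp (hv : ContDiff ℝ ∞ v) (hdiv : VectorCalculus.IsDivFree v) {M : ℝ}
    (hM : ∀ x, ‖v x‖ = M) (h1 : ∫⁻ x, ‖iteratedFDeriv ℝ 1 v x‖ₑ ^ 2 < ⊤) (h2 : ∫⁻ x, ‖iteratedFDeriv ℝ 2 v x‖ₑ ^ 2 < ⊤)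
    (μ : Measure E3) [IsFiniteMeasure μ]
    (hμ : ∀ ψ : E3 → E3, ContDiff ℝ ∞ ψ → HasCompactSupport ψ → VectorCalculus.IsDivFree ψ →
      Jst v * J1 v ψ - kStar ^ 2 * M ^ 2 * (Wpa v * A1 v ψ + Zen v * C1 v ψ) = ∫ x, ⟪v x, ψ x⟫_ℝ ∂μ)
    (hc0 : c 0 = 0) (hc1 : c 1 = 0) (hc2 : c 2 ≠ 0) (hcM : ‖c‖ = M)
    (hL6 : MemLp (fun x => v x - c) 6 volume)
    (hφ : ContDiff ℝ ∞ φ) (hφc : HasCompactSupport φ) :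
    ⟪(fderiv ℝ (fun z => fderiv ℝ φ z (EuclideanSpace.single (2 : Fin 3) (1 : ℝ))) 0 (EuclideanSpace.single (0 : Fin 3) (1 : ℝ))) •
        EuclideanSpace.single (0 : Fin 3) (1 : ℝ) +
      (fderiv ℝ (fun z => fderiv ℝ φ z (EuclideanSpace.single (2 : Fin 3) (1 : ℝ))) 0 (EuclideanSpace.single (1 : Fin 3) (1 : ℝ))) •
        EuclideanSpace.single (1 : Fin 3) (1 : ℝ) +
      (fderiv ℝ (fun z => fderiv ℝ φ z (EuclideanSpace.single (2 : Fin 3) (1 : ℝ))) 0 (EuclideanSpace.single (2 : Fin 3) (1 : ℝ)) -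
        (Δ φ) 0) • EuclideanSpace.single (2 : Fin 3) (1 : ℝ), ∫ x, v x ∂μ⟫_ℝ = 0 := by
  -- names: `e i`, the scalar `∂₂φ`, the coefficients
  set e0 : E3 := EuclideanSpace.single (0 : Fin 3) (1 : ℝ) with he0
  set e1 : E3 := EuclideanSpace.single (1 : Fin 3) (1 : ℝ) with he1
  set e2 : E3 := EuclideanSpace.single (2 : Fin 3) (1 : ℝ) with he2
  set p : E3 → ℝ := fun z => fderiv ℝ φ z e2 with hp
  have hpC : ContDiff ℝ ∞ p := contDiff_fderiv_apply_const hφ e2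
  have hpc : HasCompactSupport p := hasCompactSupport_fderiv_apply_const hφc e2
  set F₀ : E3 → ℝ := fun z => fderiv ℝ p z e0 with hF₀
  set F₁ : E3 → ℝ := fun z => fderiv ℝ p z e1 with hF₁
  set g : E3 → ℝ := fun z => (Δ p) z with hg
  set F₂ : E3 → ℝ := fun z => fderiv ℝ p z e2 - (Δ φ) z with hF₂
  have hF₀C : ContDiff ℝ ∞ F₀ := contDiff_fderiv_apply_const hpC e0
  have hF₁C : ContDiff ℝ ∞ F₁ := contDiff_fderiv_apply_const hpC e1
  have hΔφC : ContDiff ℝ ∞ (fun z => (Δ φ) z) := contDiff_laplacian_scalar_top hφ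
  have hF₂C : ContDiff ℝ ∞ F₂ := (contDiff_fderiv_apply_const hpC e2).sub hΔφC
  have hgC : ContDiff ℝ ∞ g := contDiff_laplacian_scalar_top hpC
  -- compact supports
  have hΔsupp : ∀ {q : E3 → ℝ}, ContDiff ℝ ∞ q → HasCompactSupport q → HasCompactSupport fun z => (Δ q) z := by
    intro q hq hqc
    rw [laplacian_eq_sum_fun (hq.of_le (by norm_cast))]
    have : (fun z => ∑ i : Fin 3, fderiv ℝ (fun u => fderiv ℝ q u (EuclideanSpace.basisFun (Fin 3) ℝ i)) z
        (EuclideanSpace.basisFun (Fin 3) ℝ i)) = fun z =>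
        fderiv ℝ (fun u => fderiv ℝ q u (EuclideanSpace.basisFun (Fin 3) ℝ 0)) z (EuclideanSpace.basisFun (Fin 3) ℝ 0) +
        fderiv ℝ (fun u => fderiv ℝ q u (EuclideanSpace.basisFun (Fin 3) ℝ 1)) z (EuclideanSpace.basisFun (Fin 3) ℝ 1) +
        fderiv ℝ (fun u => fderiv ℝ q u (EuclideanSpace.basisFun (Fin 3) ℝ 2)) z (EuclideanSpace.basisFun (Fin 3) ℝ 2) := by
      funext z; rw [Fin.sum_univ_three]
    rw [this]
    exact ((hasCompactSupport_fderiv_apply_const (hasCompactSupport_fderiv_apply_const hqc _) _).add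
      (hasCompactSupport_fderiv_apply_const (hasCompactSupport_fderiv_apply_const hqc _) _)).add
      (hasCompactSupport_fderiv_apply_const (hasCompactSupport_fderiv_apply_const hqc _) _)
  have hF₀c : HasCompactSupport F₀ := hasCompactSupport_fderiv_apply_const hpc e0
  have hF₁c : HasCompactSupport F₁ := hasCompactSupport_fderiv_apply_const hpc e1
  have hF₂c : HasCompactSupport F₂ := (hasCompactSupport_fderiv_apply_const hpc e2).sub (hΔsupp hφ hφc)
  have hgc : HasCompactSupport g := hΔsupp hpC hpc
  -- the test field
  set Ψ : E3 → E3 := fun y => F₀ y • e0 + F₁ y • e1 + F₂ y • e2 with hΨ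
  have hΨC : ContDiff ℝ ∞ Ψ := ((hF₀C.smul contDiff_const).add (hF₁C.smul contDiff_const)).add (hF₂C.smul contDiff_const)
  have hΨc : HasCompactSupport Ψ :=
    ((hF₀c.smul_right (f' := fun _ => e0)).add (hF₁c.smul_right (f' := fun _ => e1))).add (hF₂c.smul_right (f' := fun _ => e2))
  -- divergence free: `div Ψ = Δ(∂₂φ) − ∂₂(Δφ) = 0`
  have hΨdiv : VectorCalculus.IsDivFree Ψ := by
    intro y
    rw [hΨ, divergence_comb (hF₀C.differentiable (by simp)) (hF₁C.differentiable (by simp)) (hF₂C.differentiable (by simp)) y]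
    have hsum : (Δ p) y = fderiv ℝ F₀ y e0 + fderiv ℝ F₁ y e1 + fderiv ℝ (fun z => fderiv ℝ p z e2) y e2 := by
      rw [congrFun (laplacian_eq_sum_fun (hpC.of_le (by norm_cast))) y, Fin.sum_univ_three]
      simp only [EuclideanSpace.basisFun_apply]
      rfl
    have hF₂d : fderiv ℝ F₂ y e2 = fderiv ℝ (fun z => fderiv ℝ p z e2) y e2 - fderiv ℝ (fun z => (Δ φ) z) y e2 := by
      rw [hF₂, fderiv_fun_sub ((contDiff_fderiv_apply_const hpC e2).differentiable (by simp) y) (hΔφC.differentiable (by simp) y),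
        FunLike.coe_sub, Pi.sub_apply]
    rw [hF₂d, ← laplacian_fderiv_apply_comm hφ y e2]
    show fderiv ℝ F₀ y e0 + fderiv ℝ F₁ y e1 + (fderiv ℝ (fun z => fderiv ℝ p z e2) y e2 - (Δ p) y) = 0
    rw [hsum]; ring
  -- horizontal components of `ΔΨ` are `∂ᵢ g`, `g = Δ(∂₂φ)`
  have hcomp : ∀ (i : Fin 3), (fun z => Ψ z i) = ![F₀, F₁, F₂] i := by
    intro i; funext z
    show (F₀ z • e0 + F₁ z • e1 + F₂ z • e2) i = _
    rw [he0, he1, he2, comb_apply]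
    fin_cases i <;> rfl
  have hhor : ∀ (y : E3) (i : Fin 3), i ≠ 2 → (Δ Ψ) y i = fderiv ℝ g y (EuclideanSpace.single i (1 : ℝ)) := by
    intro y i hi
    have hΨ2y : ContDiffAt ℝ 2 Ψ y := (hΨC.of_le (by norm_cast)).contDiffAt
    have hci' := ContDiffAt.laplacian_CLM_comp_left (l := (EuclideanSpace.proj i : E3 →L[ℝ] ℝ)) hΨ2y
    have hci : (Δ (fun z => Ψ z i)) y = (Δ Ψ) y i := by
      have h' : (Δ (fun z => Ψ z i)) y = (EuclideanSpace.proj i : E3 →L[ℝ] ℝ) ((Δ Ψ) y) := hci'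
      rw [h']; rfl
    rw [← hci, hcomp i]
    fin_cases i
    · show (Δ F₀) y = fderiv ℝ g y (EuclideanSpace.single 0 1)
      rw [hF₀, laplacian_fderiv_apply_comm hpC y e0]
    · show (Δ F₁) y = fderiv ℝ g y (EuclideanSpace.single 1 1)
      rw [hF₁, laplacian_fderiv_apply_comm hpC y e1]
    · exact absurd rfl hi
  -- apply the barycentre law
  have h := inner_barycentre_eq_zero_of_horizontalGradient_of_memLp hv hdiv hM h1 h2 μ hμ hc0 hc1 hc2 hcM hL6 hΨC hΨc hΨdiv
    (hgC.of_le (by norm_cast)) hgc hhor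
  simpa [hΨ, hF₀, hF₁, hF₂, hp] using h

/-- **`∫ v dμ = 0` for EVERY residue object** (flat or jet): hypotheses as in `inner_testField_barycentre_eq_zero_of_memLp`
(axial frame, `v − c ∈ L⁶`). [folklore] -/
theorem integral_barycentre_eq_zero_of_memLp (hv : ContDiff ℝ ∞ v) (hdiv : VectorCalculus.IsDivFree v) {M : ℝ}
    (hM : ∀ x, ‖v x‖ = M) (h1 : ∫⁻ x, ‖iteratedFDeriv ℝ 1 v x‖ₑ ^ 2 < ⊤) (h2 : ∫⁻ x, ‖iteratedFDeriv ℝ 2 v x‖ₑ ^ 2 < ⊤)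
    (μ : Measure E3) [IsFiniteMeasure μ]
    (hμ : ∀ ψ : E3 → E3, ContDiff ℝ ∞ ψ → HasCompactSupport ψ → VectorCalculus.IsDivFree ψ →
      Jst v * J1 v ψ - kStar ^ 2 * M ^ 2 * (Wpa v * A1 v ψ + Zen v * C1 v ψ) = ∫ x, ⟪v x, ψ x⟫_ℝ ∂μ)
    (hc0 : c 0 = 0) (hc1 : c 1 = 0) (hc2 : c 2 ≠ 0) (hcM : ‖c‖ = M)
    (hL6 : MemLp (fun x => v x - c) 6 volume) :
    (∫ x, v x ∂μ) = 0 := by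
  set b : E3 := ∫ x, v x ∂μ with hb
  -- a smooth bump `χ ≡ 1` near `0`
  let χ : ContDiffBump (0 : E3) := ⟨1, 2, one_pos, one_lt_two⟩
  have hχC : ContDiff ℝ ∞ (χ : E3 → ℝ) := χ.contDiff
  have hχc : HasCompactSupport (χ : E3 → ℝ) := χ.hasCompactSupport
  have hχ1 : (χ : E3 → ℝ) =ᶠ[𝓝 (0 : E3)] 1 := χ.eventuallyEq_one
  -- the generic step: a bumped polynomial `χ·q` has the test vector of `q`
  have key : ∀ {q : E3 → ℝ}, ContDiff ℝ ∞ q →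
      ⟪(fderiv ℝ (fun z => fderiv ℝ q z (EuclideanSpace.single (2 : Fin 3) (1 : ℝ))) 0 (EuclideanSpace.single (0 : Fin 3) (1 : ℝ))) •
          EuclideanSpace.single (0 : Fin 3) (1 : ℝ) +
        (fderiv ℝ (fun z => fderiv ℝ q z (EuclideanSpace.single (2 : Fin 3) (1 : ℝ))) 0 (EuclideanSpace.single (1 : Fin 3) (1 : ℝ))) •
          EuclideanSpace.single (1 : Fin 3) (1 : ℝ) +
        (fderiv ℝ (fun z => fderiv ℝ q z (EuclideanSpace.single (2 : Fin 3) (1 : ℝ))) 0 (EuclideanSpace.single (2 : Fin 3) (1 : ℝ)) -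
          (Δ q) 0) • EuclideanSpace.single (2 : Fin 3) (1 : ℝ), b⟫_ℝ = 0 := by
    intro q hq
    set φ' : E3 → ℝ := fun y => χ y * q y with hφ'
    have hφ'C : ContDiff ℝ ∞ φ' := hχC.mul hq
    have hφ'c : HasCompactSupport φ' := hχc.mul_right
    have heq : φ' =ᶠ[𝓝 (0 : E3)] q := by
      filter_upwards [hχ1] with y hy
      simp only [hφ', hy, Pi.one_apply, one_mul]
    have h := inner_testField_barycentre_eq_zero_of_memLp hv hdiv hM h1 h2 μ hμ hc0 hc1 hc2 hcM hL6 hφ'C hφ'c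
    rw [fderiv_fderiv_apply_congr_of_eventuallyEq heq, fderiv_fderiv_apply_congr_of_eventuallyEq heq,
      fderiv_fderiv_apply_congr_of_eventuallyEq heq, laplacian_congr_of_eventuallyEq heq] at h
    exact h
  -- the three components
  have hb0 : b 0 = 0 := by
    have h := key (contDiff_coord_mul_coord 0 2)
    obtain ⟨hw, hΔ⟩ := model_coord_mul 0 (by decide)
    rw [hw, hw, hw, hΔ] at h
    simpa [EuclideanSpace.inner_single_left] using h
  have hb1 : b 1 = 0 := by
    have h := key (contDiff_coord_mul_coord 1 2)
    obtain ⟨hw, hΔ⟩ := model_coord_mul 1 (by decide)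
    rw [hw, hw, hw, hΔ] at h
    simpa [EuclideanSpace.inner_single_left] using h
  have hb2 : b 2 = 0 := by
    have h := key contDiff_neg_half_sq
    obtain ⟨hw, hΔ⟩ := model_neg_sq
    rw [hw, hw, hw, hΔ] at h
    simpa [EuclideanSpace.inner_single_left] using h
  ext i
  fin_cases i
  · exact hb0
  · exact hb1
  · exact hb2

end ExtremiserLiouville

end Summit.NavierStokesRegularity.NavierStokesRegularity.Theorems

end
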